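import Literature.AlgebraicGeometry.Villamayor2007.ChangeOfVariables
import Mathlib.RingTheory.ReesAlgebra
import HarnessLib

/-!
# Villamayor 2007, Rem. 1.14 / 1.15 / Thm. 1.16: the specialization `R̄_b → S` PRESERVES DEGREES
# (`I_r ⊆ I^r` when the coefficients satisfy `a_i ∈ I^i`), the claim (1.15) behind Thm. 1.16 (ii), and the
# vanishing of the `I_r` at purely ramified points (Thm. 1.16 (i), one direction) — PROVED

O. E. Villamayor U., *Hypersurface singularities in positive characteristic*, Adv. Math. **213** (2007)
687–733 = arXiv:math/0606796 [Villamayor2007]; locators «p00NN Lnn» = chunk · line of the held arXiv text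
(`lit read paper:arxiv-math_0606796`, chunks p0006–p0009 re-read before typing). Sequel of
`ChangeOfVariables.lean` (`specialize_taylor`, `specialize_scale`, `elimIdeal_taylor`). Campaign `res-hironaka`
(D-0089), ladder rung LIT-6. PROOF file: theorems only, no definitions, no named facts; nothing of Hironaka's 2017
manuscript is referred to.

## What is proved

* **Rem. 1.14 / 1.15 p0008 L138–L151, p0009 L8–L16 («`φ : R̄_b → S` preserves degrees»).** «This property holds
  if and only if `ν_S(φ(H_i)) ≥ n_i` … every homogeneous element `H`, of degree `n`, can be expressed as
  `H = G(H₁,…,H_r)`, where `G` is weighted homogeneous of degree `n`» and «`H` is also a weighted homogeneous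
  polynomial of degree `m` in the `s_i`'s, provided each `s_i` is given weight `i`». RING-LEVEL FORM, for ANY
  ideal `I` of ANY `k`-algebra `S` in place of the powers of the maximal ideal of a regular local ring
  (`ν_S(x) ≥ n ⟺ x ∈ M^n`): if `a_i ∈ I^i` for `i = 1,…,b` then `specialize a G ∈ I^r` for every `G ∈ [R̄_b]_r`
  (`specialize_mem_pow`), i.e. `I_r ⊆ I^r` (`elimIdeal_le_pow`). The weighted homogeneity is used in the form
  PROVED in `ChangeOfVariables.lean` (`specialize_scale`: `G((u^i a_i)_i) = u^r G(a)`), over `S[U]` with the Rees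
  algebra `⊕ Iⁿ Uⁿ` (Mathlib `reesAlgebra`) as the bookkeeping device — no order function is needed.
* **1.15 (casas) p0009 L27–L53 = the proof of Thm. 1.16 (ii).** «if `Q` is a `b`-fold point of this
  hypersurface, there is a suitable change of coordinate `Z₁ = Z − s`, `s ∈ S`, so that: `f(Z) = Z₁^b + c₁Z₁^{b−1}
  + … + c_b ∈ S[Z]`, and `ν_S(c_i) ≥ i` … As this morphism … preserves degrees, it follows that
  `ν_S(G_{b,i}(c₁,…,c_b)) ≥ n_i`. On the other hand `G_{b,i}(c₁,…,c_b) = G_{b,i}(a₁,…,a_b)` since these functions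
  are invariant by these changes of the coordinate `Z`, hence `ν_S(G_{b,i}(a₁,…,a_b)) ≥ n_i`.» PROVED as
  `elimIdeal_le_pow_of_taylor`: if for some `s ∈ S` the coefficients `c = coeffVec b (taylor s (monicOf a))` of
  `f(Z₁ + s)` satisfy `c_i ∈ I^i`, then `I_r(f) ⊆ I^r` for all `r`. What is NOT proved here is the INPUT of
  Thm. 1.16 (ii) — that a point of multiplicity `b` supplies such an `s` («we use Zariski's multiplicity formula
  (see [ZS], Corollary 1, page 299)», p0009 L30–L31); consumers feed the prepared form directly.
* **Thm. 1.16 (i) p0009 L55–L64, direction «purely ramified ⟹ in `V(I_r)`», with Lemma 1.3 1) ⟹ 2) p0006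
  L70–L78 and Def. 1.1 p0006 L36–L43 («purely ramified at `P` if and only if the class of `f(Z)` in `k̄(P)[Z]` has
  a unique root», i.e. `f̄ = (Z − α)^b`).** PROVED: `elimIdeal_X_sub_C_pow` — the elimination ideals `I_r`,
  `r ≥ 1`, of `(Z − α)^b` are ZERO (over any `k`-algebra); hence `elimIdeal_map_eq_bot_of_map_eq_pow` — if under
  `φ : S → K` the polynomial `f` becomes `(Z − α)^b`, then `φ(I_r) = 0`, i.e. `I_r ⊆ ker φ` (`elimIdeal_le_ker`):
  every purely ramified prime contains all `I_r`, `r ≥ 1`. The converse inclusion of Thm. 1.16 (i) (the radical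
  computation 1.11 / Lemma 1.3 2) ⟹ 1)) is NOT proved here.

## References

* O. E. Villamayor U., Adv. Math. 213 (2007) 687–733 = arXiv:math/0606796: Def. 1.1, Lemma 1.3, Rem. 1.14, 1.15,
  Thm. 1.16. [Villamayor2007]
* O. Zariski, P. Samuel, Commutative Algebra II, Ch. VIII §10 Cor. 1 p. 299 (the multiplicity formula quoted at
  p0009 L30–L31; not used here). [ZariskiSamuelII]
-/

noncomputable section

open scoped Polynomial

namespace Literature.AlgebraicGeometry.Villamayor2007

open MvPolynomial

universe u v w

section DegreePreserving

variable (k : Type v) [CommRing k] {S : Type w} [CommRing S] [Algebra k S] {b : ℕ}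

/-- The specialization `G ↦ G(a)` takes values in every `k`-subalgebra containing the coefficients `a_i`
(«`h` … is a polynomial expression on the coefficients `a_i` of `f(Z)`», p0007 L65–L66).
[cite: Villamayor2007, §1.5 p0007 L65–L66] -/
theorem specialize_mem_of_forall_mem (A' : Subalgebra k S) (a : Fin b → S) (ha : ∀ i, a i ∈ A')
    (G : symmetricSubalgebra (Fin b) k) : specialize k a G ∈ A' := by
  have h : specialize k a G ∈ (aeval (fun i : Fin b => (-1 : S) ^ ((i : ℕ) + 1) * a i)).range := ⟨_, rfl⟩
  rw [MvPolynomial.aeval_range] at h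
  refine (Algebra.adjoin_le ?_ : Algebra.adjoin k _ ≤ A') h
  rintro x ⟨i, rfl⟩
  exact A'.mul_mem (A'.pow_mem (A'.neg_mem A'.one_mem) _) (ha i)

/-- Over `S[U]`, specializing at the constant vector `C ∘ a` is `C` of the specialization at `a`
(compatibility with base change, p0006 L67–L68). [cite: Villamayor2007, Def. 1.2 p0006 L67–L68] -/
theorem specialize_C_comp (a : Fin b → S) (G : symmetricSubalgebra (Fin b) k) :
    specialize k (fun i : Fin b => Polynomial.C (a i)) G = Polynomial.C (specialize k a G) := by
  have h' : (fun i : Fin b => Polynomial.C (a i)) = ⇑(IsScalarTower.toAlgHom k S S[X]) ∘ a := by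
    funext i
    rw [Function.comp_apply, IsScalarTower.toAlgHom_apply, Polynomial.algebraMap_apply,
      Algebra.algebraMap_self_apply]
  rw [h', specialize_comp, AlgHom.comp_apply, IsScalarTower.toAlgHom_apply, Polynomial.algebraMap_apply,
      Algebra.algebraMap_self_apply]

/-- **The specialization preserves degrees** [Villamayor 2007, Rem. 1.14 p0008 L138–L151 and 1.15 p0009 L8–L16:
«`φ : R̄_b → S` preserves degrees if and only if `ν_S(φ(G_{b,i})) ≥ n_i` … `H` is also a weighted homogeneous
polynomial of degree `m` in the `s_i`'s, provided each `s_i` is given weight `i`»], ring-level form: if the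
coefficients satisfy `a_i ∈ I^i` (`i = 1,…,b`; `a i = a_{i+1}`), then `G(a) ∈ I^r` for every `G ∈ [R̄_b]_r`. (For a
regular local `(S, M)` and `I = M` this is `ν_S(φ(H)) ≥ deg H`.) Proof: by `specialize_scale` over `S[U]`,
`U^r · G(a) = G((a_i U^i)_i)` lies in the Rees algebra `⊕ Iⁿ Uⁿ`; read off the coefficient of `U^r`.
[cite: Villamayor2007, Rem. 1.14 p0008 L138–L151] -/
theorem specialize_mem_pow (I : Ideal S) (a : Fin b → S) (ha : ∀ i : Fin b, a i ∈ I ^ ((i : ℕ) + 1))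
    {G : MvPolynomial (Fin b) k} {r : ℕ} (hG : G ∈ univElimPiece (Fin b) k (fun _ : Fin b => ()) r) :
    specialize k a ⟨G, univElimOne_le_symmetricSubalgebra hG.1⟩ ∈ I ^ r := by
  have hmem : specialize k (fun i : Fin b => Polynomial.C (a i) * Polynomial.X ^ ((i : ℕ) + 1))
      ⟨G, univElimOne_le_symmetricSubalgebra hG.1⟩ ∈ (reesAlgebra I).restrictScalars k := by
    refine specialize_mem_of_forall_mem k _ _ (fun i => ?_) _
    rw [Subalgebra.mem_restrictScalars, Polynomial.C_mul_X_pow_eq_monomial]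
    exact reesAlgebra.monomial_mem.mpr (ha i)
  rw [specialize_scale k (fun i : Fin b => Polynomial.C (a i)) Polynomial.X hG, specialize_C_comp,
    Subalgebra.mem_restrictScalars, mem_reesAlgebra_iff] at hmem
  have h := hmem r
  rwa [mul_comm, Polynomial.coeff_C_mul_X_pow, if_pos rfl] at h

variable {k}

/-- **`I_r ⊆ I^r` when `a_i ∈ I^i`** — the ideal form of degree preservation (Rem. 1.14 with (gradlocal), p0009
L13–L16 «`φ : R̄_b → S` preserves degrees if and only if `ν_S(φ(G_{b,i})) ≥ n_i`»). [cite: Villamayor2007, Rem. 1.14 p0008 L138–L151] -/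
theorem elimIdeal_le_pow (I : Ideal S) (a : Fin b → S) (ha : ∀ i : Fin b, a i ∈ I ^ ((i : ℕ) + 1)) (r : ℕ) :
    elimIdeal k a r ≤ I ^ r := by
  refine Ideal.span_le.mpr ?_
  rintro _ ⟨H, rfl⟩
  exact specialize_mem_pow k I a ha H.2

/-- The same for `ℋ_f ⊆ R̄_f`: `I^{(2)}_r ⊆ I^r`. [cite: Villamayor2007, Rem. 1.14 p0008 L138–L151] -/
theorem hElimIdeal_le_pow (I : Ideal S) (a : Fin b → S) (ha : ∀ i : Fin b, a i ∈ I ^ ((i : ℕ) + 1)) (r : ℕ) :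
    hElimIdeal k a r ≤ I ^ r :=
  (hElimIdeal_le_elimIdeal a r).trans (elimIdeal_le_pow I a ha r)

/-- **1.15 (casas) — the argument proving Thm. 1.16 (ii)** [Villamayor 2007, p0009 L27–L53 «there is a suitable
change of coordinate `Z₁ = Z − s`, `s ∈ S`, so that: `f(Z) = Z₁^b + c₁Z₁^{b−1} + … + c_b`, and `ν_S(c_i) ≥ i` … it
follows that `ν_S(G_{b,i}(c₁,…,c_b)) ≥ n_i`. On the other hand `G_{b,i}(c₁,…,c_b) = G_{b,i}(a₁,…,a_b)` since these
functions are invariant by these changes of the coordinate `Z`, hence `ν_S(G_{b,i}(a₁,…,a_b)) ≥ n_i`»]: if for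
some `s ∈ S` the coefficients `c = coeffVec b (taylor s (monicOf a))` of `f(Z₁ + s)` satisfy `c_i ∈ I^i`, then
`I_r(f) ⊆ I^r` for every `r`. (The printed INPUT «`Q` a `b`-fold point ⟹ such an `s` exists», via Zariski's
multiplicity formula, is not part of this statement.) [cite: Villamayor2007, 1.15 p0009 L27–L53] -/
theorem elimIdeal_le_pow_of_taylor (I : Ideal S) (a : Fin b → S) (s : S)
    (hc : ∀ i : Fin b, coeffVec b (Polynomial.taylor s (monicOf a)) i ∈ I ^ ((i : ℕ) + 1)) (r : ℕ) :
    elimIdeal k a r ≤ I ^ r := by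
  rw [← elimIdeal_taylor a s r]
  exact elimIdeal_le_pow I _ hc r

/-- `ℋ_f`-version of 1.15. [cite: Villamayor2007, 1.15 p0009 L27–L53] -/
theorem hElimIdeal_le_pow_of_taylor (I : Ideal S) (a : Fin b → S) (s : S)
    (hc : ∀ i : Fin b, coeffVec b (Polynomial.taylor s (monicOf a)) i ∈ I ^ ((i : ℕ) + 1)) (r : ℕ) :
    hElimIdeal k a r ≤ I ^ r :=
  (hElimIdeal_le_elimIdeal a r).trans (elimIdeal_le_pow_of_taylor I a s hc r)

/-- The same hypothesis stated on an arbitrary monic `f` of degree `b`: if `f(Z₁ + s) = Z₁^b + c₁Z₁^{b−1} + … + c_b`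
with `c_i ∈ I^i`, then `I_r(f) ⊆ I^r`. [cite: Villamayor2007, 1.15 p0009 L27–L53] -/
theorem elimIdeal_le_pow_of_taylor_of_monic (I : Ideal S) {f : S[X]} (hmonic : f.Monic) (hdeg : f.natDegree = b)
    (s : S) (hc : ∀ i : Fin b, coeffVec b (Polynomial.taylor s f) i ∈ I ^ ((i : ℕ) + 1)) (r : ℕ) :
    elimIdeal k (coeffVec b f) r ≤ I ^ r := by
  refine elimIdeal_le_pow_of_taylor I _ s (fun i => ?_) r
  rw [monicOf_coeffVec hmonic hdeg]
  exact hc i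

end DegreePreserving

/-! ## Thm. 1.16 (i), direction ⟸: the `I_r` vanish where `f` is a pure `b`-th power -/

section PurelyRamified

variable (k : Type v) [CommRing k] {S : Type w} [CommRing S] [Algebra k S] {b : ℕ}

/-- `(Z − α)^b` is the translate `Z₁ = Z + α` of `Z^b = monicOf 0`. [cite: Villamayor2007, Lemma 1.3 p0006 L70–L73] -/
theorem X_sub_C_pow_eq_taylor (α : S) :
    (Polynomial.X - Polynomial.C α) ^ b = Polynomial.taylor (-α) (monicOf (0 : Fin b → S)) := by
  rw [monicOf, Polynomial.taylor_apply]
  simp [sub_eq_add_neg]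

/-- **The elimination ideals of a pure power vanish** [Villamayor 2007, Lemma 1.3 «1) `f(Z) = (Z − α)^b` …
That 1) implies 2) is clear», p0006 L70–L78; Thm. 1.16 (i) p0009 L55–L64]: `I_r((Z − α)^b) = 0` for every `r ≥ 1`,
over any `k`-algebra `S` and any `α ∈ S`. Proof: translate to `Z^b` (`elimIdeal_taylor`), whose coefficient vector
is `0`, so `I_r ⊆ (0)^r` by degree preservation. [cite: Villamayor2007, Thm. 1.16 (i) p0009 L55–L64] -/
theorem elimIdeal_X_sub_C_pow (α : S) {r : ℕ} (hr : 1 ≤ r) :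
    elimIdeal k (coeffVec b ((Polynomial.X - Polynomial.C α) ^ b)) r = ⊥ := by
  rw [X_sub_C_pow_eq_taylor, elimIdeal_taylor]
  have h := elimIdeal_le_pow (k := k) (⊥ : Ideal S) (0 : Fin b → S) (fun i => Ideal.zero_mem _) r
  rw [← Ideal.zero_eq_bot, zero_pow (Nat.one_le_iff_ne_zero.mp hr)] at h
  exact le_bot_iff.mp h

/-- `ℋ`-version: `I^{(2)}_r((Z − α)^b) = 0` for `r ≥ 1`. [cite: Villamayor2007, Thm. 1.16 (i) p0009 L55–L64] -/
theorem hElimIdeal_X_sub_C_pow (α : S) {r : ℕ} (hr : 1 ≤ r) :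
    hElimIdeal k (coeffVec b ((Polynomial.X - Polynomial.C α) ^ b)) r = ⊥ :=
  le_bot_iff.mp ((hElimIdeal_le_elimIdeal _ r).trans (elimIdeal_X_sub_C_pow k α hr).le)

variable {k}

/-- **Thm. 1.16 (i), direction «purely ramified points lie in `V(I_r)`»** [Villamayor 2007, p0009 L55–L64 with
Def. 1.1 p0006 L36–L43 «purely ramified at `P` if and only if the class of `f(Z)` in `k̄(P)[Z]` has a unique root»]:
if under a `k`-algebra map `φ : S → K` (e.g. `S → k̄(P)`) the polynomial `f = monicOf a` becomes a pure power
`(Z − α)^b`, then `φ(I_r(f)) = 0` for every `r ≥ 1`. [cite: Villamayor2007, Thm. 1.16 (i) p0009 L55–L64] -/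
theorem elimIdeal_map_eq_bot_of_map_eq_pow {K : Type w} [CommRing K] [Algebra k K] (φ : S →ₐ[k] K)
    (a : Fin b → S) (α : K) (h : (monicOf a).map (φ : S →+* K) = (Polynomial.X - Polynomial.C α) ^ b)
    {r : ℕ} (hr : 1 ≤ r) : (elimIdeal k a r).map φ = ⊥ := by
  rw [← elimIdeal_map, ← coeffVec_monicOf (⇑φ ∘ a), ← monicOf_map φ a, h]
  exact elimIdeal_X_sub_C_pow k α hr

/-- Equivalently `I_r(f) ⊆ ker φ` for `r ≥ 1`: every prime at which `f` is purely ramified contains all the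
elimination ideals. [cite: Villamayor2007, Thm. 1.16 (i) p0009 L55–L64] -/
theorem elimIdeal_le_ker_of_map_eq_pow {K : Type w} [CommRing K] [Algebra k K] (φ : S →ₐ[k] K)
    (a : Fin b → S) (α : K) (h : (monicOf a).map (φ : S →+* K) = (Polynomial.X - Polynomial.C α) ^ b)
    {r : ℕ} (hr : 1 ≤ r) : elimIdeal k a r ≤ RingHom.ker (φ : S →+* K) := by
  rw [← Ideal.map_eq_bot_iff_le_ker]
  exact elimIdeal_map_eq_bot_of_map_eq_pow φ a α h hr

end PurelyRamified

end Literature.AlgebraicGeometry.Villamayor2007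

end
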